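import Summits.HubbardSuperconductivity.HubbardLadder.Bounds.KinWeightCeilingTPrimeSymmetry
import HarnessLib

/-!
# Hubbard ladder — Bounds: the kinetic-weight ceiling for the `t–t'` class (all `n`, `U`, `t'`)
(Split in two for the 400-line limit, statements unchanged: the rotation-symmetry / kinetic-weight /
symbol toolbox is part 1 = `KinWeightCeilingTPrimeSymmetry`; this file is part 2.)

HONEST FRAMING (cell pub-hubbard): ladder R1–R4 with certified numbers; no claim on H/H₀.
These are bounds for MODEL CLASSES (finite-range lattice fermions with gauge-invariant
interactions); no materials claim. Companion text: `pub-hubbard/paper/bounds.tex` §2 (Thm 2.1,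
Cor. 2.2(ii)–(iii) with `t' ≠ 0`); tables `pub-hubbard/pub-hubbard-bounds/BOUNDS.md` (T2.ii–iii)
and `EXTREMISERS.md` (its certified column `s_L(n, t')` = the right-hand side below at the optimal
`ν`, over `L²`; e.g. `max_N s_32(N, -1/4) = 0.92828` against `max_N s_32(N, 0) = 0.80927`).

The `t–t'` torus of the tree is `hubbardTorusTT' L 1 t' U = hamiltonian (n.n.) 1 U +
hamiltonian (diagonal) t' 0` (`HubbardNNNHopping.lean`; Xu et al., Science 384 (2024), eq. (1)).
With `K_j(ψ) = Σ_{z,σ} Re⟨ψ, c†_{z+j,σ} c_{z,σ} ψ⟩` for a jump `j` (`K_x = K_{e₁}`, `K_y = K_{e₂}`)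
and `K_diag = K_{e₁+e₂} + K_{e₁-e₂}`, the `x`-kinetic weight of the model is
`K₁ = K_x + t' K_diag` (`⟨-T₁⟩ = 2K₁ = |Λ| 𝒦₁`, the f-sum / diamagnetic ceiling numerator).
* `kinWeightTT'_sum_le` (Cor. 2.2(ii)): for EVERY Fock vector `ψ` (`L ≥ 2`), every `t'`, `ν`,
  `K_x + K_y + 2t' K_diag ≤ ν Re⟨ψ, Nψ⟩ + 2‖ψ‖² Σ_k (cos k₁ + cos k₂ + 4t' cos k₁ cos k₂ - ν)⁺`
  (`k_i = 2πκ_i/L`; Lieb–Loss bathtub in Legendre form for the symbol of `-(T₁ + T₂)`).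
* `groundStateKinWeightCeilingTT'_holds : GroundStateKinWeightCeilingTT'` (Cor. 2.2(iii)): for
  `L ≥ 3`, all `t'`, `U`, `δ ≥ -1`, the `(N_L, S^z = 0)` sector, `N_L = 2⌊(1-δ)L²/2⌋`, contains a
  unit ground state with `K_x + t' K_diag ≤ ν N_L/2 + Σ_k (⋯ - ν)⁺` for every `ν` (two-state
  minimum over `ψ`, `Γ(r)ψ`: the rotation `Γ(r)` is a symmetry of the `t–t'` torus, exchanges
  `K_x`, `K_y` and fixes `K_diag`); at `t' = 0` it is the tree's `GroundStateKinWeightCeiling`.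
Method: shift matrices `(S_j)_{xz} = [x = z + j]`, diagonalised by the site plane waves.
NOT claimed: a flux-stiffness statement for `t' ≠ 0` (the tree's flux Hamiltonian and f-sum
floor are typed at `t' = 0`), a thermodynamic limit, anything at `T > 0`.
Sources: Hazra–Verma–Randeria, PRX 9 (2019) 031049, eqs. (2)–(6) [HVR2019]; Paramekanti–
Trivedi–Randeria, PRB 57 (1998) 11639 [PTR1998]; Lieb–Loss, *Analysis* (2001) Thm 1.14
[LiebLoss2001]; Xu et al., Science 384 (2024) eadh7691 [XuEtAl2024]; Scalapino, Phys. Rep. 250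
(1995) 329, §2 [Scalapino1995].
-/

noncomputable section

namespace Summit.HubbardSuperconductivity.HubbardLadder.Bounds

open Matrix Finset Real
open Literature.MathematicalPhysics.QuantumLattice
open Literature.MathematicalPhysics.QuantumFieldTheory
open Literature.Probability.LatticeModels
open Literature.MathematicalPhysics.QuantumLattice.LangerMattis
open Literature.MathematicalPhysics.QuantumLattice.RayleighBound
open scoped ComplexOrder ComplexConjugate

variable {L : ℕ} [NeZero L]

/-- The shift matrix `S_j`: `(S_j)_{xz} = [x = z + j]` (torus coordinates). -/
def shiftMatrix (j : TorusSite 2 L) : Matrix (FermionTorus 2 L) (FermionTorus 2 L) ℂ :=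
  Matrix.of fun x z => if x.toTorusSite = z.toTorusSite + j then 1 else 0

/-- `dΓ_σ(S_j) = Σ_z c†_{z+j,σ} c_{z,σ}`. -/
theorem dGammaSpin_shiftMatrix (j : TorusSite 2 L) (σ : Fin 2) :
    dGammaSpin σ (shiftMatrix (L := L) j) =
      ∑ z : TorusSite 2 L, creation (orb (FermionTorus.ofTorusSite (z + j)) σ) *
        annihilation (orb (FermionTorus.ofTorusSite z) σ) := by
  unfold dGammaSpin
  rw [Finset.sum_comm, FermionTorus.sum_eq_sum_torusSite]
  refine Finset.sum_congr rfl fun z _ => ?_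
  rw [FermionTorus.sum_eq_sum_torusSite]
  have hiff : ∀ x : TorusSite 2 L, x = z + j ↔ z + j = x := fun x => eq_comm
  simp only [shiftMatrix, Matrix.of_apply, FermionTorus.toTorusSite_ofTorusSite, ite_smul,
    one_smul, zero_smul, hiff, Finset.sum_ite_eq, Finset.mem_univ, if_true]

/-- `Σ_σ Re⟨ψ, dΓ_σ(S_j) ψ⟩ = K_j(ψ)`. -/
theorem sum_re_dGammaSpin_shiftMatrix (j : TorusSite 2 L) (ψ : Fock (Orb (FermionTorus 2 L))) :
    ∑ σ : Fin 2, (star ψ ⬝ᵥ (dGammaSpin σ (shiftMatrix j) *ᵥ ψ)).re =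
      shiftKinWeight j ψ := by
  unfold shiftKinWeight
  rw [Finset.sum_comm]
  refine Finset.sum_congr rfl fun σ _ => ?_
  rw [dGammaSpin_shiftMatrix, Matrix.sum_mulVec, dotProduct_sum, Complex.re_sum]

/-- **Plane waves diagonalise the shifts**: `(S_j W)_{xk} = W_{xk} conj χ_k(j)`. -/
theorem shiftMatrix_mul_sitePlaneWave_apply (j : TorusSite 2 L) (x k : FermionTorus 2 L) :
    (shiftMatrix j * sitePlaneWave 2 L) x k =
      sitePlaneWave 2 L x k * conj (torusChar k.toTorusSite j) := by
  rw [Matrix.mul_apply]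
  simp only [shiftMatrix, sitePlaneWave, Matrix.of_apply, ite_mul, one_mul, zero_mul]
  rw [FermionTorus.sum_eq_sum_torusSite]
  simp only [FermionTorus.toTorusSite_ofTorusSite]
  have hiff : ∀ z : TorusSite 2 L, x.toTorusSite = z + j ↔ z = x.toTorusSite - j := fun z => by
    constructor
    · intro h; rw [h, add_sub_cancel_right]
    · rintro rfl; rw [sub_add_cancel]
  simp only [hiff, Finset.sum_ite_eq', Finset.mem_univ, if_true]
  rw [torusChar_sub_right]
  ring

/-- The one-body matrix of `c (T₁ + T₂)`:
`M_c(t') = c [Σ_{±,i} S_{±eᵢ} + 2t' Σ_{±,s} S_{±j_s}]` (`j₀ = e₁+e₂`, `j₁ = e₁-e₂`; the factor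
`2t'` because every diagonal bond lies in both `T₁` and `T₂`). -/
def ttMatrix (c t' : ℝ) : Matrix (FermionTorus 2 L) (FermionTorus 2 L) ℂ :=
  (c : ℂ) • ((shiftMatrix (Pi.single 0 1) + shiftMatrix (-Pi.single 0 1)) +
    (shiftMatrix (Pi.single 1 1) + shiftMatrix (-Pi.single 1 1)) +
    ((2 * t' : ℝ) : ℂ) •
      ((shiftMatrix (torusDiagJump L 0) + shiftMatrix (-torusDiagJump L 0)) +
        (shiftMatrix (torusDiagJump L 1) + shiftMatrix (-torusDiagJump L 1))))

/-- **Plane waves diagonalise `M_c(t')`**: `M_c(t') W = W diag(w_c)` (`L ≥ 2`). -/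
theorem ttMatrix_mul_sitePlaneWave (hL : 2 ≤ L) (c t' : ℝ) :
    ttMatrix c t' * sitePlaneWave 2 L =
      sitePlaneWave 2 L * diagonal (fun k => ((ttSymbol c t' k.toTorusSite : ℝ) : ℂ)) := by
  ext x k
  rw [mul_diagonal]
  simp only [ttMatrix, Matrix.smul_mul, Matrix.add_mul, Matrix.smul_apply, Matrix.add_apply,
    shiftMatrix_mul_sitePlaneWave_apply, smul_eq_mul, torusDiagJump_zero_eq,
    torusDiagJump_one_eq, torusChar_neg_right, torusChar_add_right, torusChar_sub_right, map_mul,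
    Complex.conj_conj]
  set a : ℂ := torusChar k.toTorusSite (Pi.single 0 1) with ha_def
  set b : ℂ := torusChar k.toTorusSite (Pi.single 1 1) with hb_def
  have hc : ((ttSymbol c t' k.toTorusSite : ℝ) : ℂ) = (c : ℂ) *
      ((a + conj a) + (b + conj b) + ((2 * t' : ℝ) : ℂ) * ((a + conj a) * (b + conj b))) := by
    rw [ha_def, hb_def, torusChar_single_add_conj hL k.toTorusSite 0,
      torusChar_single_add_conj hL k.toTorusSite 1, ttSymbol]
    push_cast
    ring
  rw [hc]; ring

/-- `M_c(t') = W diag(w_c) Wᴴ` with `W` the site plane waves (`L ≥ 2`). -/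
theorem ttMatrix_eq_conj (hL : 2 ≤ L) (c t' : ℝ) :
    ttMatrix c t' =
      sitePlaneWave 2 L * diagonal (fun k => ((ttSymbol c t' k.toTorusSite : ℝ) : ℂ)) *
        (sitePlaneWave 2 L)ᴴ := by
  rw [← ttMatrix_mul_sitePlaneWave hL c t', Matrix.mul_assoc, sitePlaneWave_mul_conjTranspose,
    Matrix.mul_one]

/-- `M_c(t')` is Hermitian (`L ≥ 2`). -/
theorem isHermitian_ttMatrix (hL : 2 ≤ L) (c t' : ℝ) :
    (ttMatrix (L := L) c t').IsHermitian := by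
  rw [ttMatrix_eq_conj hL c t']
  refine Matrix.isHermitian_mul_mul_conjTranspose _
    (Matrix.isHermitian_diagonal_of_self_adjoint _ ?_)
  exact funext fun k => Complex.conj_ofReal _

/-- **Spectral sums of `M_c(t')` are momentum sums**: `Σ_j f(λ_j) = Σ_k f(w_c(k))`. -/
theorem sum_eigenvalues_ttMatrix (hL : 2 ≤ L) (c t' : ℝ) (f : ℝ → ℝ) :
    ∑ j, f ((isHermitian_ttMatrix hL c t').eigenvalues j) =
      ∑ k : TorusSite 2 L, f (ttSymbol c t' k) := by
  rw [Literature.Computability.AlgebraicComplexity.sum_eigenvalues_eq_roots_sum _ f,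
    ttMatrix_eq_conj hL c t',
    Literature.Computability.AlgebraicComplexity.charpoly_conj_of_mul_eq_one _ _ _
      conjTranspose_sitePlaneWave_mul, Matrix.charpoly_diagonal,
    Literature.Computability.AlgebraicComplexity.roots_prod_X_sub_C_fun, Multiset.map_map,
    ← Finset.sum_eq_multiset_sum, FermionTorus.sum_eq_sum_torusSite]
  refine Finset.sum_congr rfl fun z _ => ?_
  simp only [Function.comp_apply, RCLike.re_to_complex, Complex.ofReal_re,
    FermionTorus.toTorusSite_ofTorusSite]

/-- `Σ_σ Re⟨ψ, dΓ_σ(M_c(t')) ψ⟩ = 2c (K_x + K_y + 2t' K_diag)(ψ)`. -/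
theorem sum_re_dGammaSpin_ttMatrix (c t' : ℝ) (ψ : Fock (Orb (FermionTorus 2 L))) :
    ∑ σ : Fin 2, (star ψ ⬝ᵥ (dGammaSpin σ (ttMatrix c t') *ᵥ ψ)).re =
      2 * c * (kinWeightDir 0 ψ + kinWeightDir 1 ψ + 2 * t' * kinWeightDiag ψ) := by
  have hK := fun j : TorusSite 2 L => sum_re_dGammaSpin_shiftMatrix (L := L) j ψ
  rw [kinWeightDir_eq_shiftKinWeight, kinWeightDir_eq_shiftKinWeight]
  unfold kinWeightDiag
  simp only [ttMatrix, dGammaSpin_smul, dGammaSpin_add, Matrix.smul_mulVec, Matrix.add_mulVec,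
    dotProduct_smul, dotProduct_add, smul_eq_mul, Complex.add_re, Complex.mul_re,
    Complex.ofReal_re, Complex.ofReal_im, zero_mul, sub_zero, mul_add, Finset.sum_add_distrib,
    ← Finset.mul_sum, hK, shiftKinWeight_neg]
  ring

/-- **Summed bathtub bound for the `t–t'` class, every state** (bounds.tex Cor. 2.2(ii)):
`K_x(ψ) + K_y(ψ) + 2t' K_diag(ψ) ≤ ν Re⟨ψ, N ψ⟩ + 2 ‖ψ‖² Σ_k (w(k)/2 - ν)⁺`, `L ≥ 2`. -/
theorem kinWeightTT'_sum_le (hL : 2 ≤ L) (t' ν : ℝ) (ψ : Fock (Orb (FermionTorus 2 L))) :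
    kinWeightDir 0 ψ + kinWeightDir 1 ψ + 2 * t' * kinWeightDiag ψ ≤
      ν * (star ψ ⬝ᵥ (totalNumber *ᵥ ψ)).re +
        2 * (∑ k : TorusSite 2 L, ttBathtub t' ν k) * (star ψ ⬝ᵥ ψ).re := by
  set S : ℝ := ∑ k : TorusSite 2 L, ttBathtub t' ν k with hS_def
  have h := fun σ : Fin 2 =>
    FreeKinetic.sum_min_sub_mul_normSq_le σ (isHermitian_ttMatrix hL (-1) t') (-(2 * ν)) ψ
  have h2 : ∑ j, min ((isHermitian_ttMatrix hL (-1) t').eigenvalues j - -(2 * ν)) 0 =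
      -(2 * S) := by
    rw [sum_eigenvalues_ttMatrix hL (-1) t' (fun x => min (x - -(2 * ν)) 0), hS_def,
      Finset.mul_sum, ← Finset.sum_neg_distrib]
    exact Finset.sum_congr rfl fun k _ => ttSymbol_neg_one_sub t' ν k
  have h' : ∀ σ : Fin 2, -(2 * S) * normSq ψ +
        -(2 * ν) * (star ψ ⬝ᵥ ((∑ x : FermionTorus 2 L, numberOp x σ) *ᵥ ψ)).re ≤
      (star ψ ⬝ᵥ (dGammaSpin σ (ttMatrix (-1) t') *ᵥ ψ)).re := fun σ =>
    (congrArg (fun a : ℝ => a * normSq ψ +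
      -(2 * ν) * (star ψ ⬝ᵥ ((∑ x : FermionTorus 2 L, numberOp x σ) *ᵥ ψ)).re) h2).symm.trans_le
      (h σ)
  have hsum := Finset.sum_le_sum fun σ (_ : σ ∈ (Finset.univ : Finset (Fin 2))) => h' σ
  rw [Finset.sum_add_distrib, Finset.sum_const, ← Finset.mul_sum,
    sum_re_numberOp_eq_re_totalNumber ψ, sum_re_dGammaSpin_ttMatrix] at hsum
  rw [star_dotProduct_self_eq_normSq ψ, Complex.ofReal_re]
  simp only [Finset.card_univ, Fintype.card_fin, nsmul_eq_mul, Nat.cast_ofNat] at hsum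
  linarith

/-- **Typed obligation T2.iii(t') — the rotation-averaged kinetic ceiling for the `t–t'` class.**
For `L ≥ 3`, every `t'`, `U`, `δ ≥ -1`: the `(N_L, S^z = 0)` sector of
`hubbardTorusTT' L 1 t' U`, `N_L = 2⌊(1-δ)L²/2⌋`, contains a unit ground state `ψ` whose
`x`-kinetic weight `K₁(ψ) = K_x(ψ) + t' K_diag(ψ)` (`= |Λ| 𝒦₁/2`) obeys, for every `ν`,
`K₁(ψ) ≤ ν N_L/2 + Σ_k (cos(2πk₁/L) + cos(2πk₂/L) + 4t' cos(2πk₁/L) cos(2πk₂/L) - ν)⁺`.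
bounds.tex Cor. 2.2(iii); Hazra–Verma–Randeria, PRX 9 (2019) 031049, eqs. (5)–(6) with the
sharp bathtub constant in place of `2ñ`; at `t' = 0` it is `GroundStateKinWeightCeiling`. -/
@[conjecture] def GroundStateKinWeightCeilingTT' : Prop :=
  ∀ (L : ℕ) [NeZero L], 3 ≤ L → ∀ (t' U δ : ℝ), -1 ≤ δ →
    ∃ ψ : Fock (Orb (FermionTorus 2 L)),
      IsGroundStateInSector (hubbardTorusTT' L 1 t' U) (2 * ⌊(1 - δ) * (L : ℝ) ^ 2 / 2⌋₊) 0 ψ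
      ∧ star ψ ⬝ᵥ ψ = 1 ∧
      ∀ ν : ℝ, kinWeightX ψ + t' * kinWeightDiag ψ ≤
        ν * ((2 * ⌊(1 - δ) * (L : ℝ) ^ 2 / 2⌋₊ : ℕ) : ℝ) / 2 +
          ∑ k : TorusSite 2 L,
            max (Real.cos (latticeMomentum L k 0) + Real.cos (latticeMomentum L k 1) +
              4 * t' * (Real.cos (latticeMomentum L k 0) * Real.cos (latticeMomentum L k 1))
              - ν) 0

/-- **Proof of `GroundStateKinWeightCeilingTT'`** (two-state minimum over `ψ`, `Γ(r)ψ`). -/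
theorem groundStateKinWeightCeilingTT'_holds : GroundStateKinWeightCeilingTT' := by
  intro L _ hL t' U δ hδ
  have hL2 : 2 ≤ L := by omega
  obtain ⟨ψ, h1, hgs⟩ := exists_unit_groundStateInSector_hubbardTorusTT' L 1 t' U
    (NoGo.floor_pairNumber_le δ hδ L)
  set n : ℕ := ⌊(1 - δ) * (L : ℝ) ^ 2 / 2⌋₊ with hn_def
  set φ : Fock (Orb (FermionTorus 2 L)) :=
    fockMapOp (d4Orb (DihedralGroup.r 1 : DihedralGroup 4)) *ᵥ ψ with hφ_def
  have hφgs : IsGroundStateInSector (hubbardTorusTT' L 1 t' U) (2 * n) 0 φ :=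
    isGroundStateInSector_hubbardTorusTT'_rot hgs
  have hφ1 : star φ ⬝ᵥ φ = 1 := by
    rw [hφ_def, star_fockMapOp_mulVec_dotProduct_self _ (d4Orb_bijective _).injective, h1]
  have hNφ : IsNParticle (2 * n) φ := ((mem_szSector_iff _ _ _).1 hφgs.1).1
  have hKy : kinWeightDir 1 φ = kinWeightX ψ := kinWeightDir_one_rot ψ
  have hKd : t' * kinWeightDiag φ = t' * kinWeightDiag ψ := by rw [hφ_def, kinWeightDiag_rot]
  have hb : ∀ ν : ℝ, kinWeightX φ + kinWeightX ψ + 2 * t' * kinWeightDiag φ ≤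
      ν * ((2 * n : ℕ) : ℝ) + 2 * ∑ k : TorusSite 2 L, ttBathtub t' ν k := by
    intro ν
    have h := kinWeightTT'_sum_le hL2 t' ν φ
    rwa [LangerMattis.totalNumber_mulVec_of_isNParticle hNφ, dotProduct_smul, hφ1, smul_eq_mul,
      mul_one, Complex.natCast_re, Complex.one_re, mul_one, hKy, ← kinWeightX_eq_kinWeightDir]
      at h
  simp only [ttBathtub] at hb
  by_cases hcmp : kinWeightX ψ + t' * kinWeightDiag ψ ≤ kinWeightX φ + t' * kinWeightDiag φ
  · exact ⟨ψ, hgs, h1, fun ν => by have h := hb ν; linarith⟩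
  · push Not at hcmp
    exact ⟨φ, hφgs, hφ1, fun ν => by have h := hb ν; linarith⟩

end Summit.HubbardSuperconductivity.HubbardLadder.Bounds

end
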